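import Literature.Claims.NS.Magsanop2026
import Literature.Barriers.NavierStokesRegularity.ScalingAudit
import Literature.Analysis.FluidPDE.VorticityCalculus
import Literature.Analysis.FluidPDE.VorticityStretching
import Literature.Analysis.FluidPDE.LocalBiotSavartCalculus
import Literature.Analysis.FluidPDE.AncientSimilarityVorticity
import Literature.Analysis.FluidPDE.VectorCalculusProofs
import Literature.Analysis.FluidPDE.PressureRepresentation
import Summits.NavierStokesRegularity.NavierStokesRegularity.Theorems.SoloRefuteMagsanop2026GN
import Summits.NavierStokesRegularity.NavierStokesRegularity.Theorems.SoloRefuteLindgren2012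
import Mathlib.MeasureTheory.Measure.Haar.NormedSpace
import HarnessLib

/-!
# C145 `Magsanop2026` — records-grade kernel object: `¬ Step_L24_holder` by the SCALING AUDIT,
# with the enstrophy-production identity `∫⟪(v·∇)v, Δv⟫ = ∫⟪ω, (∇×ω)×v⟫` and a non-zero witness

`Literature.Claims.NS.Magsanop2026.Step_L24_holder` types p.3 l.34–49 «|∫(u·∇)u·Δu| ≤
‖u‖_{L⁶}‖∇u‖_{L³}‖Δu‖_{L²} ≤ CE(t)^{3/4}‖Δu‖^{3/2}_{L²}» as ONE absolute constant `C` with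
`|∫⟪(v·∇)v, Δv⟫| ≤ C · energy(v)^{3/4} · lapSq(v)^{3/4}` for every smooth compactly supported divergence-free
field `v` on `ℝ³`. Under the spatial dilations `v ↦ v(λ·)` (`λ > 0`) the left side is INVARIANT
(`(v_λ·∇)v_λ = λ((v·∇)v)(λ·)`, `Δv_λ = λ²(Δv)(λ·)`, `dx ↦ λ⁻³dx`), while `energy` has degree `-3` and
`lapSq` degree `+1`, so the right side has degree `¾·(-3) + ¾·1 = -3/2 ≠ 0`, and the catalogued barrier
`ScalingAudit.not_exists_forall_le_rpow_mul_rpow_of_exponent_ne` [cite: Tao2007WhyNSHard, supercriticality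
paragraph] refutes the display — PROVIDED one divergence-free test field has `∫⟪(v·∇)v, Δv⟫ ≠ 0`.

The witness is supplied by an IDENTITY plus the landed Lindgren witness: for smooth compactly supported
divergence-free `v` with `ω = curl v`,
`∫⟪(v·∇)v, Δv⟫ = ∫⟪ω, (ω·∇)v⟫ − ∫⟪ω, (v·∇)ω⟫ = ∫⟪ω, (∇×ω)×v⟫`
(first equality: `Δv = −curl curl v`, curl self-adjointness, `curl((v·∇)v) = (v·∇)ω − (ω·∇)v`; second:
triple product, curl self-adjointness, `curl(v×ω) = (ω·∇)v − (v·∇)ω` for divergence-free `v`, `ω`), and the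
right side is `Literature.Claims.NS.Lindgren2012.stretch v`, negative on the landed field
`Theorems.Lindgren2012.wit` (`stretch_wit_neg`, C03-family kit).

Main results (namespace `Summit.NavierStokesRegularity.NavierStokesRegularity.Theorems.Magsanop2026`; all
names new):
* `integral_inner_convect_laplacian_eq` — `∫⟪(v·∇)v, Δv⟫ = ∫⟪ω,(ω·∇)v⟫ − ∫⟪ω,(v·∇)ω⟫`;
* `lindgrenStretch_eq` — `Lindgren2012.stretch v =` the same difference;
* `integral_inner_convect_laplacian_eq_lindgrenStretch`, `integral_inner_convect_laplacian_wit_neg`;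
* `integral_inner_convect_laplacian_comp_smul` (dilation invariance), `energy_comp_smul` (degree `-3`);
* `not_Step_L24_holder : ¬ Literature.Claims.NS.Magsanop2026.Step_L24_holder`.

WHAT THIS IS NOT: not a claim about NS regularity or blow-up; not a claim about any author beyond the
typed locator [cite: Magsanop2026, §3 p.3 l.34–49]. `Step_L24_holder` is an unconsumed SUSPICIOUS display
of the skeleton (ADJUDICATED #132 is located at `Step_Thm2`); records-grade only.
-/

set_option linter.dupNamespace false

open MeasureTheory Set Function
open scoped ContDiff Laplacian RealInnerProductSpace

namespace Summit.NavierStokesRegularity.NavierStokesRegularity.Theorems.Magsanop2026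

open Literature.Analysis.FluidPDE Literature.Claims.NS.Magsanop2026
open Summit.NavierStokesRegularity.NavierStokesRegularity.Theorems.Lindgren2012 (wit contDiff_wit
  hasCompactSupport_wit isDivFree_wit stretch_wit_neg)

/-! ## The enstrophy-production identity -/

/-- **`∫⟪(v·∇)v, Δv⟫ = ∫⟪ω, (ω·∇)v⟫ − ∫⟪ω, (v·∇)ω⟫`** for a smooth compactly supported divergence-free
field on `ℝ³` (`ω = curl v`): `Δv = −curl curl v` (`laplacian_eq_neg_curl_curl`), the curl is self-adjoint
against compactly supported fields (`integral_inner_curl_eq_integral_inner_curl`), and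
`curl((v·∇)v) = (v·∇)ω − (ω·∇)v` (`curl_convect_self_of_isDivFree`). [cite: MajdaBertozziCUP2002, §1.1 (vector identities), (1.33)] -/
theorem integral_inner_convect_laplacian_eq {v : E3 → E3} (hv : ContDiff ℝ ∞ v)
    (hc : HasCompactSupport v) (hdiv : VectorCalculus.IsDivFree v) :
    ∫ x, ⟪convect v v x, (Δ v) x⟫ =
      (∫ x, ⟪curl v x, convect (curl v) v x⟫) - ∫ x, ⟪curl v x, convect v (curl v) x⟫ := by
  have hv1 : ContDiff ℝ 1 v := hv.of_le (by norm_cast)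
  have hv2 : ContDiff ℝ 2 v := hv.of_le (by norm_cast)
  have hω1 : ContDiff ℝ 1 (curl v) := contDiff_curl (n := 1) hv2
  have hωc : HasCompactSupport (curl v) := hasCompactSupport_curl hc
  have hcv : ContDiff ℝ 1 (convect v v) := contDiff_convect_self (n := 1) hv2
  have hcvc : HasCompactSupport (convect v v) :=
    hc.mono fun x hx => by
      contrapose! hx
      simp only [mem_support, not_not] at hx
      simp [convect, hx]
  have h1 : ∀ x, ⟪convect v v x, (Δ v) x⟫ = -⟪curl (curl v) x, convect v v x⟫ := fun x => by
    rw [laplacian_eq_neg_curl_curl hv2 hdiv x, inner_neg_right, real_inner_comm]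
  simp_rw [h1, integral_neg]
  rw [integral_inner_curl_eq_integral_inner_curl hω1 hcv hcvc]
  simp_rw [curl_convect_self_of_isDivFree hv2 hdiv, inner_sub_right]
  have hi1 : Integrable (fun x => ⟪curl v x, convect v (curl v) x⟫) :=
    integrable_inner_of_hasCompactSupport_left (continuous_curl hv1)
      ((hω1.continuous_fderiv one_ne_zero).clm_apply hv.continuous) hωc
  have hi2 : Integrable (fun x => ⟪curl v x, convect (curl v) v x⟫) :=
    integrable_inner_of_hasCompactSupport_left (continuous_curl hv1)
      ((hv.continuous_fderiv (by simp)).clm_apply (continuous_curl hv1)) hωc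
  rw [integral_sub hi1 hi2]
  ring

/-- **`∫⟪ω, (∇×ω)×v⟫ = ∫⟪ω, (ω·∇)v⟫ − ∫⟪ω, (v·∇)ω⟫`** — Lindgren's `stretch v` (C03-family skeleton
`Literature.Claims.NS.Lindgren2012.stretch`) in gradient form, for a smooth compactly supported
divergence-free field: cyclic triple product, curl self-adjointness, and
`curl(v × ω) = (ω·∇)v − (div v)ω + (div ω)v − (v·∇)ω` (`curl_cross_apply`) with `div v = div ω = 0`.
[cite: MajdaBertozziCUP2002, §1.1 (vector identities)] -/
theorem lindgrenStretch_eq {v : E3 → E3} (hv : ContDiff ℝ ∞ v)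
    (hc : HasCompactSupport v) (hdiv : VectorCalculus.IsDivFree v) :
    Literature.Claims.NS.Lindgren2012.stretch v =
      (∫ x, ⟪curl v x, convect (curl v) v x⟫) - ∫ x, ⟪curl v x, convect v (curl v) x⟫ := by
  have hv1 : ContDiff ℝ 1 v := hv.of_le (by norm_cast)
  have hv2 : ContDiff ℝ 2 v := hv.of_le (by norm_cast)
  have hω1 : ContDiff ℝ 1 (curl v) := contDiff_curl (n := 1) hv2
  have hωc : HasCompactSupport (curl v) := hasCompactSupport_curl hc
  unfold Literature.Claims.NS.Lindgren2012.stretch Literature.Claims.NS.Lindgren2012.ccurl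
  -- cyclic triple product `⟪ω, c × v⟫ = ⟪c, v × ω⟫`
  have hcyc : ∀ x, ⟪curl v x, cross (curl (curl v) x) (v x)⟫ =
      ⟪curl (curl v) x, cross (v x) (curl v x)⟫ := fun x => by
    simp only [cross, PiLp.inner_apply, RCLike.inner_apply, conj_trivial, Fin.sum_univ_three,
      cross_apply, Matrix.cons_val_zero, Matrix.cons_val_one, Matrix.cons_val_two,
      Matrix.head_cons, Matrix.tail_cons]
    ring
  simp_rw [hcyc]
  have hX : ContDiff ℝ 1 fun y => cross (v y) (curl v y) :=
    (crossCLM.contDiff.comp hv1).clm_apply hω1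
  have hXc : HasCompactSupport fun y => cross (v y) (curl v y) := by
    refine hc.mono fun x hx => ?_
    contrapose! hx
    simp only [mem_support, not_not] at hx
    simp [← crossCLM_apply, hx]
  rw [integral_inner_curl_eq_integral_inner_curl hω1 hX hXc]
  have h2 : ∀ x, curl (fun y => cross (v y) (curl v y)) x =
      convect (curl v) v x - convect v (curl v) x := fun x => by
    rw [curl_cross_apply ((hv1.differentiable one_ne_zero) x) ((hω1.differentiable one_ne_zero) x), hdiv x,
      divergence_curl_eq_zero_holds v hv2 x, zero_smul, zero_smul, sub_zero, add_zero]
    rfl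
  simp_rw [h2, inner_sub_right]
  have hi1 : Integrable (fun x => ⟪curl v x, convect (curl v) v x⟫) :=
    integrable_inner_of_hasCompactSupport_left (continuous_curl hv1)
      ((hv.continuous_fderiv (by simp)).clm_apply (continuous_curl hv1)) hωc
  have hi2 : Integrable (fun x => ⟪curl v x, convect v (curl v) x⟫) :=
    integrable_inner_of_hasCompactSupport_left (continuous_curl hv1)
      ((hω1.continuous_fderiv one_ne_zero).clm_apply hv.continuous) hωc
  exact integral_sub hi1 hi2

/-- **The enstrophy-production identity**: `∫⟪(v·∇)v, Δv⟫ = ∫⟪ω, (∇×ω)×v⟫` (= Lindgren's `stretch v`)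
for smooth compactly supported divergence-free `v` on `ℝ³`. [cite: MajdaBertozziCUP2002, §1.1 (vector identities), (1.33)] -/
theorem integral_inner_convect_laplacian_eq_lindgrenStretch {v : E3 → E3} (hv : ContDiff ℝ ∞ v)
    (hc : HasCompactSupport v) (hdiv : VectorCalculus.IsDivFree v) :
    ∫ x, ⟪convect v v x, (Δ v) x⟫ = Literature.Claims.NS.Lindgren2012.stretch v := by
  rw [integral_inner_convect_laplacian_eq hv hc hdiv, lindgrenStretch_eq hv hc hdiv]

/-- **A divergence-free test field with non-zero `∫⟪(v·∇)v, Δv⟫`**: on the landed Lindgren witness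
`Theorems.Lindgren2012.wit` (`χ(x₀²+4x₁²+9x₂²)·K⁻¹((1,1,1)×x)`) the integral is `stretch wit < 0`
(`stretch_wit_neg`). [folklore] -/
theorem integral_inner_convect_laplacian_wit_neg :
    ∫ x, ⟪convect wit wit x, (Δ wit) x⟫ < 0 := by
  rw [integral_inner_convect_laplacian_eq_lindgrenStretch contDiff_wit hasCompactSupport_wit isDivFree_wit]
  exact stretch_wit_neg

/-! ## Dilation degrees -/

/-- `((v_c·∇)v_c)(x) = c • ((v·∇)v)(c x)` for `v_c = v(c·)` (Mathlib `fderiv_comp_smul`). [folklore] -/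
theorem convect_self_comp_smul (v : E3 → E3) (c : ℝ) (x : E3) :
    convect (fun y => v (c • y)) (fun y => v (c • y)) x = c • convect v v (c • x) := by
  simp only [convect]
  rw [_root_.fderiv_comp_smul]
  rfl

/-- **Dilation invariance of `∫⟪(v·∇)v, Δv⟫`** (degree `0`): for `c > 0` and `C²` fields,
`∫⟪(v_c·∇)v_c, Δv_c⟫ = ∫⟪(v·∇)v, Δv⟫` (`c · c² · c⁻³ = 1`). [folklore] -/
theorem integral_inner_convect_laplacian_comp_smul {v : E3 → E3} (hv : ContDiff ℝ 2 v) {c : ℝ}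
    (hc : 0 < c) :
    ∫ x, ⟪convect (fun y => v (c • y)) (fun y => v (c • y)) x, (Δ (fun y => v (c • y))) x⟫ =
      ∫ x, ⟪convect v v x, (Δ v) x⟫ := by
  set g : E3 → ℝ := fun z => ⟪convect v v z, (Δ v) z⟫ with hg
  have h1 : (fun x => ⟪convect (fun y => v (c • y)) (fun y => v (c • y)) x, (Δ (fun y => v (c • y))) x⟫) =
      fun x => c ^ 3 * g (c • x) := by
    funext x
    rw [convect_self_comp_smul, laplacian_comp_smul hv c x, real_inner_smul_left, real_inner_smul_right]
    simp only [hg]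
    ring
  rw [h1, integral_const_mul, Measure.integral_comp_smul_of_nonneg volume g c (hR := hc.le),
    finrank_euclideanSpace_fin, smul_eq_mul]
  have hc3 : c ^ 3 ≠ 0 := pow_ne_zero 3 hc.ne'
  field_simp

/-- **Energy under dilation** (degree `-3`): `energy (v(c·)) = (c³)⁻¹ · energy v` for `c > 0`. [folklore] -/
theorem energy_comp_smul (v : E3 → E3) {c : ℝ} (hc : 0 < c) :
    energy (fun y => v (c • y)) = (c ^ 3)⁻¹ * energy v := by
  simp only [energy, VectorCalculus.kineticEnergy]
  rw [integral_norm_sq_comp_smul v hc]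
  ring

/-! ## The refutation -/

/-- **`Step_L24_holder` is false as typed** (p.3 l.34–49 «|∫(u·∇)u·Δu| ≤ CE^{3/4}‖Δu‖^{3/2}_{L²}» with
ONE absolute `C` on all smooth compactly supported divergence-free `u`): the catalogued SCALING AUDIT
`ScalingAudit.not_exists_forall_le_rpow_mul_rpow_of_exponent_ne` on the dilation family `δ λ v = v(λ·)`
acting on the class of divergence-free test fields — degrees `F = |∫⟪(v·∇)v, Δv⟫| ↦ 0`
(`integral_inner_convect_laplacian_comp_smul`), `energy ↦ -3`, `lapSq ↦ +1`, exponents `a = b = ¾`,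
`0 ≠ ¾·(-3) + ¾·1 = -3/2`; the witness with `F > 0` is the Lindgren field
(`integral_inner_convect_laplacian_wit_neg`). (The standard estimate has `‖∇u‖²_{L²}` where the print
has the ENERGY.) [cite: Magsanop2026, §3 p.3 l.34–49] [cite: Tao2007WhyNSHard, supercriticality paragraph] -/
theorem not_Step_L24_holder : ¬ Literature.Claims.NS.Magsanop2026.Step_L24_holder := by
  rintro ⟨C, -, hC⟩
  have hT : IsTestField wit ∧ NSWave0.IsDivFree wit :=
    ⟨⟨contDiff_wit, hasCompactSupport_wit⟩, fun x => isDivFree_wit x⟩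
  have key := Literature.Barriers.NavierStokesRegularity.ScalingAudit.not_exists_forall_le_rpow_mul_rpow_of_exponent_ne
    (X := E3 → E3) (δ := fun l w => fun y => w (l • y)) (S := {w | IsTestField w ∧ NSWave0.IsDivFree w})
    (F := fun w => |∫ x, ⟪convect w w x, (Δ w) x⟫|) (G₁ := energy) (G₂ := lapSq)
    (s := 0) (r₁ := -3) (r₂ := 1) (a := 3 / 4) (b := 3 / 4) (u₀ := wit)
    (fun l hl u hu => ⟨isTestField_comp_smul hu.1 hl.ne',
      fun x => (VectorCalculus.IsDivFree.comp_smul (fun y => hu.2 y) l) x⟩)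
    (fun l hl u hu => by
      simp only [Real.rpow_zero, one_mul]
      rw [integral_inner_convect_laplacian_comp_smul (hu.1.1.of_le (by norm_cast)) hl])
    (fun l hl u _ => by
      rw [energy_comp_smul u hl, Real.rpow_neg hl.le, Real.rpow_ofNat])
    (fun l hl u hu => by
      rw [lapSq_comp_smul (hu.1.1.of_le (by norm_cast)) hl, Real.rpow_one])
    (fun u _ => kineticEnergy_nonneg u)
    (fun u _ => integral_nonneg fun y => by positivity)
    (by norm_num) hT (abs_pos.2 integral_inner_convect_laplacian_wit_neg.ne)
  exact key ⟨C, fun u hu => by simpa [mul_assoc] using hC u hu.1 hu.2⟩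

end Summit.NavierStokesRegularity.NavierStokesRegularity.Theorems.Magsanop2026
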